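import Literature.AlgebraicGeometry.Motives.AbelianVarietyLie
import Literature.AlgebraicGeometry.Motives.AbelianVarietyTorsion
import HarnessLib

/-!
# A closed subscheme of an abelian variety killed by `n`, `n` invertible in `K`, is ÉTALE over `K`
# (Görtz–Wedhorn II, Prop. 27.187 with Cor. 27.63; Mumford, *Abelian Varieties*, §6 Application 3, §7 Thm. 4)

Layer `Literature/AlgebraicGeometry/Motives`, namespace `Literature.AlgebraicGeometry.Motives.AbelianVariety`.  Cell `hodgecm-mathlib`
(D-0151), F-DAG leaf F-2c «étaleness of `K(L) → S`», file U2 of B-p08 (g12)՚s census 2026-08-30T06:51Z (sequencer B-plan1 (g16)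
06:49:21Z): the `Â`-FREE, CARTIER-FREE step.  THEOREMS ONLY (no definition, no instance, no named fact, no `sorry`).

For an abelian variety `A` over a field `K`, a `K`-scheme `Z` with a CLOSED IMMERSION `i : Z ↪ A` over `K` such that `i`, read as a
`Z`-valued point of the group scheme `A`, is killed by an integer `n` INVERTIBLE in `K` (`i ^ n = 1` in Mathlib՚s `Hom.group`; e.g.
the finite subgroup scheme `K(L)`, killed by its order by Deligne՚s theorem — file U1), `Z` is a closed subscheme of the finite ÉTALE
`K`-group scheme `A[n] = Ker [n]_A` ([GortzWedhorn2023] Prop. 27.187: `[n]_A` is étale for `n ∈ K^×`, the tree՚s ★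
`etale_zsmul_id_holds`; kernel = base change along the unit section), hence `Z → Spec K` is a closed immersion followed by an étale
morphism — formally unramified — and flat (everything is flat over a field) and locally of finite presentation: **`Z → Spec K` is
ÉTALE** (Mathlib `Etale.of_formallyUnramified_of_flat`).  This is how [GortzWedhorn2023] Cor. 27.63 / [MumfordAV1970] §7 Thm. 4
(«in characteristic `0` every finite group scheme / isogeny kernel is étale») is used WITHOUT Cartier՚s theorem, exactly as the tree՚s ★
`IsIsogeny.etale` (`Motives/AbelianVarietyIsogenyEtale`) does for kernels of isogenies.
* `factorsThroughKer_of_pow_eq_one` — the lift `j : Z → Ker [n]_A` with `j ≫ ι = i`, `j ≫ (Ker → Spec K) = (Z → Spec K)`;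
* `formallyUnramified_hom_of_pow_eq_one` — `Z → Spec K` is formally unramified;
* **`etale_hom_of_pow_eq_one`** — `Z → Spec K` is étale;
* `etale_hom_of_forall_pow_eq_one` — the same from the hypothesis in the shape Deligne՚s theorem delivers («every `T`-valued point of
  `Z` is killed by `n` in `A(T)`»).
HC_CM is proved only modulo the 7 printed citations until rung 0 closes; this file asserts nothing about HC.

## References
* [GortzWedhorn2023] U. Görtz, T. Wedhorn, *Algebraic Geometry II: Cohomology of Schemes* (2023), Prop. 27.187, Cor. 27.63, (27.1.1).
* [MumfordAV1970] D. Mumford, *Abelian Varieties*, TIFR Studies in Mathematics 5 (1970), §6 Application 3 (p. 64), §7 Thm. 4 (p. 72).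
-/

set_option autoImplicit false

universe u

open CategoryTheory CategoryTheory.Limits AlgebraicGeometry

noncomputable section

namespace Literature.AlgebraicGeometry.Motives.AbelianVariety

open scoped MonObj

variable {K : Type u} [Field K] {A : AbelianVariety K} {Z : SchemeOver K} (i : Z ⟶ A.X)

/-- A `Z`-valued point `i` of `A` with `i ^ n = 1` lies in `Ker [n]_A (Z)` (`[n]_A = n • 𝟙 A` acts on points by `x ↦ x ^ n`,
★ `hom_zsmul_id`). [cite: GortzWedhorn2023, (27.1.1) and Prop. 27.187] -/
theorem mem_kerPoints_zsmul_of_pow_eq_one (n : ℤ) (hi : i ^ n = 1) : i ∈ Hom.kerPoints Z (n • 𝟙 A) := by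
  rw [Hom.mem_kerPoints_iff, hom_zsmul_id, GrpObj.comp_zpow, Category.comp_id]
  exact hi

/-- **The lift `j : Z → Ker [n]_A`** of a closed subscheme killed by `n`: `j ≫ ι = i` and `j ≫ (Ker [n]_A → Spec K) = (Z → Spec K)`
(universal property of `Ker [n]_A = A ×_{A, e} Spec K`, ★ `Hom.kerPointsLift`). [cite: GortzWedhorn2023, (27.1.1) and Prop. 27.187] -/
theorem factorsThroughKer_of_pow_eq_one (n : ℤ) (hi : i ^ n = 1) :
    ∃ j : Z.left ⟶ Hom.ker (n • 𝟙 A), j ≫ Hom.kerι (n • 𝟙 A) = i.left ∧ j ≫ Hom.kerToSpec (n • 𝟙 A) = Z.hom :=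
  ⟨Hom.kerPointsLift (n • 𝟙 A) ⟨i, mem_kerPoints_zsmul_of_pow_eq_one i n hi⟩,
    Hom.kerPointsLift_kerι (n • 𝟙 A) _, Hom.kerPointsLift_kerToSpec (n • 𝟙 A) _⟩

/-- **`Z → Spec K` is FORMALLY UNRAMIFIED** when `i : Z ↪ A` is a closed immersion killed by `n` invertible in `K`: `Z → Spec K`
factors as `Z → Ker [n]_A → Spec K`, a morphism whose composite with the closed immersion `Ker [n]_A ↪ A` is the closed immersion
`i` (hence formally unramified, Mathlib `FormallyUnramified.of_comp`) followed by the base change of the ÉTALE `[n]_A`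
(★ `etale_zsmul_id_holds`, [GortzWedhorn2023] Prop. 27.187) along the unit section. [cite: GortzWedhorn2023, Prop. 27.187 and Cor. 27.63] -/
theorem formallyUnramified_hom_of_pow_eq_one [IsClosedImmersion i.left] (n : ℤ) (hn : (n : K) ≠ 0) (hi : i ^ n = 1) :
    FormallyUnramified Z.hom := by
  obtain ⟨j, hjι, hj⟩ := factorsThroughKer_of_pow_eq_one i n hi
  haveI : Etale (Hom.toSchemeHom (n • 𝟙 A)) := etale_zsmul_id_holds (A := A) n hn
  haveI : Etale (Hom.kerToSpec (n • 𝟙 A)) :=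
    MorphismProperty.pullback_snd (P := @Etale) _ _ inferInstance
  haveI : FormallyUnramified (j ≫ Hom.kerι (n • 𝟙 A)) := by rw [hjι]; infer_instance
  haveI : FormallyUnramified j := FormallyUnramified.of_comp j (Hom.kerι (n • 𝟙 A))
  haveI : FormallyUnramified (Hom.kerToSpec (n • 𝟙 A)) := (Etale.iff_flat_and_formallyUnramified.mp inferInstance).2.1
  rw [← hj]
  exact MorphismProperty.comp_mem @FormallyUnramified j (Hom.kerToSpec (n • 𝟙 A)) ‹_› ‹_›

/-- **A closed subscheme of an abelian variety killed by `n`, `n` invertible in `K`, is ÉTALE over `K`**: formally unramified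
(`formallyUnramified_hom_of_pow_eq_one`), flat (over a field) and locally of finite presentation (finite type over a Noetherian base).
[cite: GortzWedhorn2023, Prop. 27.187 and Cor. 27.63] [cite: MumfordAV1970, §7 Thm. 4 (p. 72)] -/
theorem etale_hom_of_pow_eq_one [IsClosedImmersion i.left] (n : ℤ) (hn : (n : K) ≠ 0) (hi : i ^ n = 1) : Etale Z.hom := by
  haveI := formallyUnramified_hom_of_pow_eq_one i n hn hi
  haveI : Subsingleton ↥(Spec (CommRingCat.of K)) := inferInstanceAs (Subsingleton (PrimeSpectrum K))
  haveI : Flat Z.hom := inferInstance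
  haveI : LocallyOfFiniteType Z.hom := by rw [← Over.w i]; infer_instance
  haveI : LocallyOfFinitePresentation Z.hom := LocallyOfFinitePresentation.iff_locallyOfFiniteType.mpr inferInstance
  exact Etale.of_formallyUnramified_of_flat _

/-- The same with the hypothesis in the shape DELIGNE՚s theorem delivers it ([GortzWedhorn2023] Prop. 27.86): every `T`-valued point
of `Z`, read in `A(T)`, is killed by `n` — applied to the universal point `𝟙 Z`. [cite: GortzWedhorn2023, Prop. 27.187 and Cor. 27.63] -/
theorem etale_hom_of_forall_pow_eq_one [IsClosedImmersion i.left] (n : ℤ) (hn : (n : K) ≠ 0)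
    (h : ∀ (T : SchemeOver K) (u : T ⟶ Z), (u ≫ i) ^ n = 1) : Etale Z.hom :=
  etale_hom_of_pow_eq_one i n hn (by simpa using h Z (𝟙 Z))

end Literature.AlgebraicGeometry.Motives.AbelianVariety

end
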